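import Mathlib
import HarnessLib
import HarnessLib.Audit
import Summits.Parity.Statement

/-!
Route: UnitCliqueSymmetry

CLOSED (retired) 2026-08-15T13:50:21Z by planner-plancard-Parity-GeneralizedHardyLittl-bf206fb0-0 — reason: not-a-thesis (D-0027 §2.1): next-door Target RealCyclotomicPrimePairs (prime pairs in Z[zeta_p]^+) cannot reach the sub Statement GeneralizedHardyLittlewood by any honest closes theorem; opener retires the draft rather than leave it for the — note: CENSUS: opened 13:37Z as DRAFT (glue-first). Built and kept for reuse: 8 typed items elaborating rc 0 (MaynardTaoTotallyReal = CastilloEtAl2015 Thm1.1/Cor2.6/Thm2.7/§3.1 rendering; RealCyclotomicClique; MaynardTaoTotallyRealDegreeOne; SymmetryLemma; RationalTwinNorms and Assembly glue PROVED sorry-f. The file is kept as the record of this route; refuted decls are indexed as negative knowledge (`ledger negatives`).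

# Route UnitCliqueSymmetry — unit-difference cliques turn Maynard's 'some pair' into 'this pair' —
every fixed prime difference in ℤ[ζ_p]⁺, p ≥ 211 (next-door theorem + ℤ-side scope)

NEXT-DOOR THEOREM + SCOPE ROUTE, declared up front (like routes TargetGraphParity and HullDescent):
X does NOT imply
Summit.Parity.GeneralizedHardyLittlewood and is not claimed to; the Assembly concludes in the Target
`RealCyclotomicPrimePairs` (T): for
every prime p ≥ 211 and every nonzero d in O⁺ = 𝓞(ℚ(ζ_p)⁺) = ℤ[ζ_p + ζ_p⁻¹] there are infinitely
many γ ∈ O⁺ with γ and γ + d both prime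
elements — the existence half of the Gross–Smith (number-field Hardy–Littlewood) pair conjecture for
these fields, i.e. the binary
infinite-complexity case of GHL one ring over, for EVERY fixed difference (twin d = 2, consecutive d
= 1). It realises card
unit-clique-symmetrised-maynard. It suffices to show X = X1 ∧ X2 ∧ X3: X1 (MaynardTaoTotallyReal,
the named fact, FIRST crux) — Maynard–Tao
in a totally real number field K: every admissible H ⊂ O_K with |H| ≥ 105 has infinitely many
translates α + H containing two prime elements
(CastilloEtAl2015 Thm 1.1 with the totally-real numerology of Cor 2.6, Thm 2.7, §3.1); X2
(RealCyclotomicClique, crux 3: elementary, unwritten, load-bearing) — for p ≥ 5 and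
d ≠ 0 the set H = d·{c_j : 0 ≤ j ≤ (p−1)/2}, c_j = (2 − ζ^j − ζ^-j)/(2 − ζ − ζ⁻¹) = ξ_j² (squares of
the real cyclotomic units), has
|H| = (p+1)/2, pairwise differences in O⁺ˣ·d (c_i − c_j = ξ_(i+j) ξ_(i−j)) and is admissible at
every prime of O⁺; X3 (SymmetryLemma,
provable now) — in any commutative ring, if H has pairwise differences in Rˣ·d and infinitely many α
have two of α + h 'prime' for a
unit-invariant predicate, then infinitely many γ have γ and γ + d 'prime' (pigeonhole over pairs,
then rescale by the unit: symmetry pays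
the parity bit). One upgrade of X1 is ranked behind them: primes of residue degree one (crux 4 ⇒ the
rational shadow RationalTwinNorms: infinitely
many pairs of RATIONAL primes (N γ, N(γ + d)), d ∈ ℤ); Polymath's k = 50 rung (⇒ p ≥ 101) is
recorded under Numbers, not filed. The ℤ-side content is the scope lemma
PrescribedDifferenceGhost: over ℤ every prescribed-difference pair target is 2-colourable, hence
carries a balanced Liouville sign ghost in
the Polymath §8 model (TargetGraphParity's BipartiteCriterion / GhostSchema format) — the exact
sense in which ω(ℤ) = 2 is the pair-parity
obstruction that the unit clique (target graph = complete graph, ghost-free for k ≥ 3) removes in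
O⁺.
Lean: `MaynardTaoTotallyReal ∧ RealCyclotomicClique ∧ SymmetryLemma`

## Assembly
Pure logic, sorry-free in folder Sketch.lean (`assembly_sanity`): fix p ≥ 211 prime and d ≠ 0 in O⁺;
RealCyclotomicClique gives an
admissible H with |H| = (p+1)/2 ≥ 106 ≥ 105 and differences in O⁺ˣ·d; K⁺ = maximalRealSubfield
(CyclotomicField p ℚ) is a totally real
number field by Mathlib instances, so MaynardTaoTotallyReal makes {α : two of α + h prime} infinite;
SymmetryLemma with P = Prime
(unit-invariant: associated elements) yields infinitely many γ with γ, γ + d prime, i.e. the Target.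
The conclusion is the declared
next-door Target, not the sub-problem statement.

Rationale: WHY THIS LINE. Mechanism (card unit-clique-symmetrised-maynard): Maynard–Tao gives 'SOME pair among
k ≥ k₀ forms is prime infinitely often' inside every
parity barrier's allowance; the missing bit — WHICH pair — is supplied not by the sieve but by a
group acting transitively on the
differences: an admissible DIFFERENCE CLIQUE H (pairwise differences ∈ O⁺ˣ·d) makes every pair the
same pair up to a unit, so ω_d(O) ≥ k₀(θ_O)
⇒ fixed difference d (CastilloEtAl2015 Thm 1.4(i) is this move in 𝔽_q[t] with 𝔽_qˣ as the clique,
due to Entin; nobody ran it in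
characteristic 0 because it needs an admissible unit-difference set of size ≥ 105 in a TOTALLY REAL
field — the full cyclotomic field has
Lenstra's clique of size p but Hinz's level 1/(r₂ + 5/2) makes k₀ exponential in p). Imported area:
algebraic number theory of cyclotomic
units / Lenstra's exceptional sequences (Lenstra1976, LeutbecherNiklasch1989, Washington1997 Lemma
8.1) pointed at the OUTPUT of the
Maynard–Tao sieve (MaynardAnnals2015, Polymath8b2014, Hinz1988, Mitsui1956). What it does that the
eleven existing GHL routes do not: they all
attack the analytic side over ℤ (Type I/II ranges, minor arcs, Tauberian boundary behaviour, Möbius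
on determinant varieties); this line
changes the RING so that the first-moment method already proves a fixed-difference prime-pair
theorem, and states precisely
(PrescribedDifferenceGhost + the card's three-forms no-go) why the same move is void over ℤ — 'the
pair-parity ceiling 6 under GEH'
(arXiv:1910.13450 §6; Literature.Barriers.Parity.PrimePairParity) reads 'k₀(GEH) = 3 > 2 = ω(ℤ)'.
Negatives index: empty for Parity at filing;
nothing refuted is restated.

RANKED CRUXES. #0 RealCyclotomicPrimePairs (target) — (T) for every prime p ≥ 211 and every nonzero
d ∈ 𝓞(ℚ(ζ_p)⁺) (Mathlib: RingOfIntegers of the maximalRealSubfield of CyclotomicField p ℚ) the set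
of γ with γ and γ + d both prime elements is infinite — fixed-difference (twin, consecutive, any d)
prime pairs in a number ring; the conclusion of the Assembly, NOT
Summit.Parity.GeneralizedHardyLittlewood. (why it might fail: A prime-pair statement (Gross–Smith
existence for ℚ(ζ_p)⁺); it dies only with its inputs: MaynardTaoTotallyReal misrendered (Cor
2.6/Hinz numerology), or a prime of ℤ[ζ_p]⁺ of norm ≤ (p+1)/2 breaking admissibility (census says N𝔭
∈ {p} ∪ {ℓ^f ≡ ±1 mod p}: none).) [CastilloEtAl2015, GrossSmith2000,
KuperbergRodgersRodittygershon2020, Washington1997]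
#2 MaynardTaoTotallyReal (crux) — (X1, the unproved NAMED FACT the mechanism rests on — first crux
by design) for every totally real number field K and every finite H ⊂ 𝓞 K with |H| ≥ 105 that misses
a residue class modulo every prime ideal, infinitely many α ∈ 𝓞 K have α + h₁ and α + h₂ both prime
elements for two distinct h₁, h₂ ∈ H. This is CastilloEtAl2015 Thm 1.1 (m = 2) with k₀(2, K) = 105
for totally real K, as assembled in their §3.1 from Cor 2.6 (r_k = ⌈θ M_k/2⌉ primes at level θ), Thm
2.7 (Hinz1988: any θ < 1/2 for r₂ = 0) and Maynard's M_105 > 4; 'prime' = generates a principal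
prime ideal (p. 3), boxes A(N) = totally positive elements, so the conclusion is purely
ideal-theoretic. To be vendored as a cite-tagged Literature def and used as hypothesis. [difficulty:
XL] (why it might fail: A rendering, not new mathematics: CHLPT print k₀=105 for totally real K only
through Cor 2.6 (r_k=⌈θM_k/2⌉), Hinz θ<1/2 and M_105>4 (§3.1); a refuter may fault the admissibility
/ 'prime' / infinitude rendering (boxes count totally positive α; prime = principal prime ideal; 0
excluded here).) [CastilloEtAl2015, Hinz1988, MaynardAnnals2015, Mitsui1956, arXiv:1403.5808]
#3 RealCyclotomicClique (crux) — (card P2, the clique — the novel, load-bearing ingredient;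
elementary but unwritten, hence ranked) for every prime p ≥ 5 and every nonzero d ∈ O⁺ = 𝓞(ℚ(ζ_p)⁺)
there is H ⊂ O⁺ with |H| = (p+1)/2, pairwise differences in O⁺ˣ·d, missing a residue class modulo
every prime ideal. Witness H = d·{c_j : 0 ≤ j ≤ (p−1)/2}, c_j = (2 − ζ^j − ζ^-j)/(2 − ζ − ζ⁻¹) =
ξ_j² with ξ_a = ζ^((1−a)/2)(1 − ζ^a)/(1 − ζ) the real cyclotomic units (Washington1997 Lemma 8.1;
c_j ∈ ℤ[ζ + ζ⁻¹] ⊆ 𝓞(K⁺), Prop. 2.16); c_i − c_j = ξ_(i+j) ξ_(i−j) ∈ O⁺ˣ for i ≠ j; admissibility: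
at the prime 𝔮 over p (residue field 𝔽_p) c_j ≡ j², so d·H meets ≤ (p+1)/2 < p classes; every other
prime of K⁺ has norm ℓ^f ≡ ±1 (mod p) (Washington1997 Thm 2.13 restricted to K⁺), hence ≥ p − 1 >
(p+1)/2 = |d·H mod 𝔭| when d ∉ 𝔭 (differences are units), and d·H ≡ {0} when d ∈ 𝔭. Checked
symbolically for p = 5,…,23 by the card's PARI job j000139. [difficulty: L] (why it might fail:
Elementary but unwritten beyond the card's PARI check (p ≤ 23): rests on c_i − c_j = ξ_(i+j)ξ_(i−j)
and the census N𝔭 ∈ {p} ∪ {ℓ^f ≡ ±1 mod p} for primes of K⁺; a slip at 𝔭 | 2 for Fermat-type p (N𝔭 =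
p − 1) or in modelling c_j inside Mathlib's 𝓞(maximalRealSubfield) would sink the instance.)
[Washington1997, Lenstra1976, LeutbecherNiklasch1989, CastilloEtAl2015]
#4 MaynardTaoTotallyRealDegreeOne (crux) — (upgrade of X1, card K2-lite) the same conclusion with
both α + h₁ and α + h₂ of RESIDUE DEGREE ONE, i.e. |N_(K/ℚ)(α + hᵢ)| a rational prime. Expected by
re-running CastilloEtAl2015 §2.3 with the degree-one indicator: generators of degree ≥ 2 prime
ideals in the box A(N) number O(N^(n/2)(log N)^(n−1)), negligible against |P(N)| ~ c N^n/log N in S₂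
and, summed over moduli of norm ≤ |A(N)|^θ, against Hinz's level-θ bound for every θ < 1/2. It is
what turns T into a statement about pairs of RATIONAL primes (support RationalTwinNorms). [deps:
MaynardTaoTotallyReal] [difficulty: L] (why it might fail: Unprinted: the degree ≥ 2 generators must
be negligible both in S₂ (trivial) and inside the level-of-distribution sum, O(N^(nθ+n/2+ε)) against
N^n/log^B — fine for θ < 1/2 but the margin closes exactly at the θ → 1/2⁻ needed for M_105 > 4 (θ >
2/M_105 ≈ 0.4997).) [CastilloEtAl2015, Hinz1988, Mitsui1956, GrossSmith2000]
#9 SymmetryLemma (support) — (card P1, symmetry pays the parity bit) R a commutative ring, P a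
predicate on R invariant under multiplication by units, d ∈ R, H ⊂ R finite with h₁ − h₂ ∈ Rˣ·d for
all h₁ ≠ h₂ in H: if infinitely many α have P(α + h₁) ∧ P(α + h₂) for some h₁ ≠ h₂ ∈ H, then
infinitely many γ have P γ ∧ P(γ + d). Proof: finitely many pairs ⇒ one pair (h₁, h₂) serves
infinitely many α; h₁ − h₂ = u d; γ := u⁻¹(α + h₂) has γ + d = u⁻¹(α + h₁); α ↦ γ is injective. Used
with P = Prime (Assembly) and P = 'norm is a rational prime' (RationalTwinNorms). [difficulty:
provable-now] [CastilloEtAl2015, folder:Sketch.lean]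
#9 RationalTwinNorms (support) — (glue; the rational shadow of T) MaynardTaoTotallyRealDegreeOne →
RealCyclotomicClique → SymmetryLemma → for every prime p ≥ 211 and every nonzero rational integer d,
infinitely many γ ∈ 𝓞(ℚ(ζ_p)⁺) have |N γ| and |N(γ + d)| both RATIONAL PRIMES — pairs of primes (ℓ,
ℓ′) of the shape (N(x), N(x + d)) for the degree-(p−1)/2 norm form of ℤ[ζ_p + ζ_p⁻¹] ≅ ℤ^((p−1)/2).
Pure glue (sorry-free in folder Sketch.lean: the norm-prime predicate is unit-invariant since N(u) =
±1). [difficulty: provable-now] [GrossSmith2000, CastilloEtAl2015, folder:Sketch.lean]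
#9 PrescribedDifferenceGhost (support) — (ℤ-side scope lemma, the card's 'ω(ℤ) = 2' made precise in
the tree's barrier model) for every k, every h : Fin k → ℤ and every d ≠ 0 there is a sign-pattern
weight P ≥ 0 of positive mass with BALANCED one-variable marginals vanishing on every pattern in
which some pair (i, j) with h j = h i + d is (true, true): the difference-d graph on Fin k is
2-colourable by ⌊h i/d⌋ mod 2, and P = 1[ε = σ] + 1[ε = ¬σ] for that colouring σ. With
TargetGraphParity's GhostSchema (stmt-Parity-4346) this gives ¬IsSieveTheoreticDeduction for every
prescribed-difference pair target over ℤ in the Polymath §8 model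
(Literature.Barriers.Parity.PrimePairParity), for every tuple and every k — whereas the unit-clique
target in O⁺ is the complete graph K_k, ghost-free for k ≥ 3 by BipartiteCriterion
(stmt-Parity-4345). [difficulty: provable-now] [Polymath8b2014, arXiv:1407.4897,
Literature.Barriers.Parity.PrimePairParity, arXiv:1910.13450]

TWO-LAYER PLAN. Foreseen glued splits (none filed now): RealCyclotomicClique ⇐ CliqueUnits (c_j ∈ 𝓞
K⁺ and c_i − c_j ∈ (𝓞 K⁺)ˣ, Washington Lemma 8.1) →
CliqueAdmissible (residue-field census N𝔭 ∈ {p} ∪ {ℓ^f ≡ ±1 mod p} and c_j ≡ j² mod 𝔮) →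
RealCyclotomicClique; MaynardTaoTotallyReal,
once vendored as a Literature def `CastilloEtAl2015_thm11_totallyReal`, is used as hypothesis and
the Target closes as T_of_fact; if
PolymathTotallyReal lands, a support `RealCyclotomicPrimePairs101` (p ≥ 101) is filed as its
corollary; if MaynardTaoTotallyRealDegreeOne
lands, RationalTwinNorms becomes unconditional-modulo-fact in the same way.

KILL CRITERIA. (i) A refuter showing MaynardTaoTotallyReal as typed is NOT what CastilloEtAl2015
prove (e.g. a hidden restriction to h_i ∈ ℤ, or to
totally positive generators that unit rescaling could leave) forces a restate from Cor 2.6 verbatim;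
if no faithful rendering supports the
unit rescaling, close `refuted:MaynardTaoTotallyReal` — the whole line dies. (ii)
¬RealCyclotomicClique for one p ≥ 211 (a non-unit
difference c_i − c_j, or a prime of ℤ[ζ_p]⁺ of norm ≤ (p+1)/2) closes the route
`refuted:RealCyclotomicClique` (the abstract criterion
ω_d(O) ≥ k₀(θ_O) ⇒ GS(O, d) survives only as a card). (iii) A literature audit finding T
(fixed-difference prime pairs in a number ring from
Maynard–Tao + units) already in print regrades the route `known`: vendor the source, close
`superseded`. (iv) Nothing proved elsewhere in
the summit moots it (it is one ring over); conversely its closing does not move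
Summit.Parity.GeneralizedHardyLittlewood — declared.

NOT DECOMPOSED YET. The Lean anatomy of RealCyclotomicClique (membership of ζ^j + ζ^-j in the
maximal real subfield, integrality, the unit identity, the
residue-field census for primes of K⁺ including 𝔭 | 2 and Fermat-type p where N𝔭 = p − 1) — layer-2
children once a prover sizes it; the
EH/GEH rungs of the ladder (EH for ℚ(ζ₁₁)⁺ ⇒ d-twins in the quintic field via k₀ = 5 and the
6-clique; GEH for ℚ(√5) ⇒ d-twins in ℤ[φ] via
k₀ = 3 and the clique {0, 1, φ²}) — not typeable until level-of-distribution predicates for 𝓞 K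
exist in Literature; the exact clique
numbers ω_adm(ℤ[ζ_p]⁺) (is (p+1)/2 sharp?) and the least degree of a totally real field with ω_adm ≥
105 (between 7, forced by
ω_adm ≤ N𝔭₂ − 1 ≤ 2^n − 1, and 105) — numerical questions for kit, not items; the card's K1 (a
symmetry surrogate over ℤ) is NOT filed: in
the affine class it is refuted by PrescribedDifferenceGhost / the three-forms no-go, and no wider
typed class is known.

CHEAPEST FALSIFIER. Three cheap checks, all run: (1) READ CastilloEtAl2015 pp. 3, 5–6, 10–12 (done
this session from the materialised arXiv:1403.5808 text):
Thm 1.1 allows h_i ∈ O_K arbitrary distinct, 'prime' = generates a principal prime ideal, A(N) =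
totally positive boxes, Cor 2.6 gives
r_k = ⌈θ M_k/2⌉ primes, Thm 2.7 gives every θ < 1/2 for totally real K, §3.1 combines them with
M_105 > 4 — so k₀ = 105 and unit
rescaling is harmless ✓; (2) the clique: the card's PARI job j000139 (p = 5…23: all C((p+1)/2, 2)
differences units; H and 2H admissible
at every prime of norm ≤ p + 2, exactly (p+1)/2 classes at the ramified prime) ✓ plus the two-line
general proof above; (3) prior art:
the OpenAlex/S2 cited-by list of CastilloEtAl2015 (24 works, read by title this session:
Gaussian/imaginary-quadratic bounded gaps,
KRRG singular series, Rahaman's linear forms, 𝔽_q[t] papers — no fixed-difference number-field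
statement) ✓. The next cheapest kill is
a refuter's line-by-line check that Hinz1988's main theorem really delivers CHLPT's 'level θ for all
θ < 1/2' in the max-over-classes
form (2.1) used in Prop. 2.1 (moduli = all ideals 𝔮 with |𝔮| ≤ |A(N)|^θ).

NUMBERS. k₀ (pairs, m = 2) against level: 105 at θ = 1/2⁻ (MaynardAnnals2015, M_105 > 4; tree
Literature.NumberTheory.Sieve.MaynardK105), 50 with
Polymath's ε-trick (Polymath8b2014 Thm 3.13(i), M_(50,1/25) > 4.0043; tree weakDHL_fifty_two), 5
under EH (M_5 > 2), 3 under GEH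
(Polymath8b2014 Thm 3.2(xii)); 2 is parity-forbidden
(Literature.Barriers.Parity.MaynardFunctionalCeiling, PrimePairParity). Admissible
unit-difference clique numbers ω_adm: ℤ: 2; ℤ[φ]: 3 = N(2) − 1 ({0, 1, φ²}; the 4-clique {0, 1, φ²,
−φ} exists but covers 𝔽₄); ℤ[ζ_p]⁺:
≥ (p+1)/2 (this route), ≤ min N𝔭 − 1 ≤ p − 1; any K of degree n: ω_adm ≤ M(K) ≤ min N𝔭 ≤ 2^n
(Lenstra1976; arXiv:2412.05568 §2.1);
𝔽_q[t]: q − 1 (CastilloEtAl2015 Thm 1.4(i), q ≥ k₀ + 1 = 106). Thresholds: (p+1)/2 ≥ 105 ⟺ p ≥ 211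
(Target); ≥ 50 ⟺ p ≥ 101
(the unfiled k = 50 rung); EH-rung p = 11 (ω ≥ 6 > 5); GEH-rung p = 5 (ω = 3). CHLPT Cor 1.2: gaps ≤
600 in every totally real K (Engelsma's
105-tuple). Items at open: 8 (1 target, 3 cruxes, 3 support, 1 assembly).

DEFINITION REQUESTS. None needed for the items: everything is typed over Mathlib (CyclotomicField,
NumberField.maximalRealSubfield, NumberField.RingOfIntegers,
NumberField.IsTotallyReal, Prime, Algebra.norm ℤ) — checked `lean check` rc 0 in folder Sketch.lean,
including the two glue proofs. Wanted
later (not filed now): a Literature named fact `CastilloEtAl2015_maynardTao_totallyReal` (=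
MaynardTaoTotallyReal with its cite tag) under
Literature/NumberTheory/Sieve, and optionally the notion ω_d(O) (admissible difference-clique
number) if the ladder is pursued.

Novelty: Searches (2026-08-15, this session): `lit citing doi:10.1090/s0002-9939-2015-12554-3` (24 citing
works of CastilloEtAl2015, all read by
title: none on fixed differences); `lit search --source zbmath "twin prime number field prime
elements"` (5: elliptic twins, Pollack's
𝔽_q[t] specialisations, KRRG, magic squares — none); `lit search --source arxiv` same query (2:
arXiv:2001.09513, one irrelevant);
`lit galaxy search "twin primes in number fields" --star all` (0), `"gaps between prime elements"
--star all` (0); `lit search --source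
zbmath "exceptional units cliques"` (1: LeutbecherNiklasch1989) and `"Lenstra constant Euclidean
number fields exceptional units"` (2: +
Houriet 2007); `lit frontier Parity --since 2022` (30 rows, nothing on number-field prime pairs);
`lit bridges Parity --cross any`;
`lit read arXiv:1403.5808` pp. 1–6, 10–12 and `lit read arXiv:2412.05568` §2.1 (M ≤ 2^n).
OpenAlex/S2 keyword search and `lit search
--hybrid` were rate-limited / rc 75 this session (logged); the card's own searches (arXiv listings,
galaxy pdf-intelligent, vsearch)
found nothing either. Nearest prior art found: CastilloEtAl2015 (arXiv:1403.5808) Thm 1.1/Cor 1.2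
(bounded gaps ≤ 600 in totally real
K — 'some difference') and Thm 1.4(i) (Entin's 𝔽_qˣ-scaling: every constant is a gap in 𝔽_q[t], q ≥
106 — the move, in positive
characteristic); Lenstra1976 / LeutbecherNiklasch1989 (unit-difference cliques, for Euclidean
algorithms, never for sieves); GrossSmith2000
and KuperbergRodgersRodit  [refs: 10.1090/s0002-9939-2015-12554-3`, 2001.09513, 1403.5808, 2412.05568, 1910.13450, doi:10.1090/s0002-9939-2015-12554-3, CastilloEtAl2015, LeutbecherNiklasch1989, Lenstra1976, GrossSmith2000, KuperbergRodgersRodittygershon2020, Rahaman2024]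

Barriers (technique_class: symmetry-upgraded-pigeonhole, unit-difference-cliques): - technique_class: symmetry-upgraded-pigeonhole, unit-difference-cliques
- Literature.Barriers.Parity.SelbergParityBarrier: evaded in O⁺, not over ℤ: the sieve proves only
the ghost-free disjunction 'two of k ≥ 105 forms prime' (allowed), and the identification of the
pair is an algebraic covering A′ → A by unit rescaling, a step outside the barrier's model of
deductions from Type-I/II data; over ℤ the covering does not exist (PrescribedDifferenceGhost),
which is why the barrier holds there — the route's structural claim, not a circumvention.
- Literature.Barriers.Parity.PrimePairParity: same; in the Polymath §8 weighted-detection model the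
prescribed-difference target over ℤ is 2-colourable for EVERY tuple (support
PrescribedDifferenceGhost ⇒ GhostSchema ⇒ ¬IsSieveTheoreticDeduction), while the unit-clique target
is K_k, ghost-free for k ≥ 3 (TargetGraphParity BipartiteCriterion); 'GEH ⇒ 6 is optimal' becomes
'k₀(GEH) = 3 > 2 = ω(ℤ)'.
- Literature.Barriers.Parity.MaynardFunctionalCeiling: respected and load-bearing: only M_105 > 4 (θ
= 1/2⁻) and, for the rung, M_(50,1/25) > 4.0043 are used; the ladder is built on the ceiling, never
through it.
- Literature.Barriers.Parity.LinearSieveOptimality: respected — no sieve constant is improved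
anywhere; the gain is algebraic.
- Literature.Barriers.Parity.EquidistributionLimitBarrier: not met — only Hinz's level θ < 1/2 for
totally real K enters (Bombieri–Vinogradov range), no level ≥ 1/2, nothing uniform in the modulus
beyond it.
-

History (route lifecycle, newest last):
- 2026-08-15T13:50:23Z · CLOSED retired — not-a-thesis (D-0027 §2.1): next-door Target RealCyclotomicPrimePairs (prime pairs in Z[zeta_p]^+) cannot reach the sub Statement GeneralizedHardyLittlewood by any honest closes theorem; opener retire (planner-plancard-Parity-GeneralizedHardyLittl-bf206fb0-0)

sub-problem: GeneralizedHardyLittlewood · status: closed(retired) · opened planner-plancard-Parity-GeneralizedHardyLittl-bf206fb0-0 2026-08-15T13:35:29Z · rev 0 · ledger route-Parity-UnitCliqueSymmetry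
GENERATED by the gate from the ledger (D-0016/17). Provers cite these decls: `theorem foo : Summit.Parity.GeneralizedHardyLittlewood.Theses.UnitCliqueSymmetry.<Decl> := …` in Summits/Parity/GeneralizedHardyLittlewood/Theorems/<Name>.lean.
-/

namespace Summit.Parity.GeneralizedHardyLittlewood.Theses.UnitCliqueSymmetry

open scoped BigOperators Topology Manifold Classical MeasureTheory ProbabilityTheory Matrix InnerProductSpace ComplexConjugate ContinuousMap
open Filter Set Function TopologicalSpace MeasureTheory

attribute [summit_statement] _root_.GeneralizedHardyLittlewood

/-- item stmt-Parity-8861 · target · rank 0 · closed · moot by None · by planner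
why it might fail: A prime-pair statement (Gross–Smith existence for ℚ(ζ_p)⁺); it dies only with its inputs: MaynardTaoTotallyReal misrendered (Cor 2.6/Hinz numerology), or a prime of ℤ[ζ_p]⁺ of norm ≤ (p+1)/2 breaking admissibility (census says N𝔭 ∈ {p} ∪ {ℓ^f ≡ ±1 mod p}: none).
sources: CastilloEtAl2015, GrossSmith2000, KuperbergRodgersRodittygershon2020, Washington1997
[target] (T) for every prime p ≥ 211 and every nonzero d ∈ 𝓞(ℚ(ζ_p)⁺) (Mathlib: RingOfIntegers of
the maximalRealSubfield of CyclotomicField p ℚ) the set of γ with γ and γ + d both prime elements is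
infinite — fixed-difference (twin, consecutive, any d) prime pairs in a number ring; the conclusion
of the Assembly, NOT Summit.Parity.GeneralizedHardyLittlewood. -/
@[route_item "route-Parity-UnitCliqueSymmetry"]
def RealCyclotomicPrimePairs : Prop :=
  ∀ p : ℕ, p.Prime → 211 ≤ p → ∀ d : NumberField.RingOfIntegers (NumberField.maximalRealSubfield (CyclotomicField p ℚ)), d ≠ 0 → {γ : NumberField.RingOfIntegers (NumberField.maximalRealSubfield (CyclotomicField p ℚ)) | Prime γ ∧ Prime (γ + d)}.Infinite

/-- item stmt-Parity-8862 · crux · rank 2 · closed · moot by None · by planner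
why it might fail: A rendering, not new mathematics: CHLPT print k₀=105 for totally real K only through Cor 2.6 (r_k=⌈θM_k/2⌉), Hinz θ<1/2 and M_105>4 (§3.1); a refuter may fault the admissibility / 'prime' / infinitude rendering (boxes count totally positive α; prime = principal prime ideal; 0 excluded here).
sources: CastilloEtAl2015, Hinz1988, MaynardAnnals2015, Mitsui1956, arXiv:1403.5808
[crux] (X1, the unproved NAMED FACT the mechanism rests on — first crux by design) for every totally
real number field K and every finite H ⊂ 𝓞 K with |H| ≥ 105 that misses a residue class modulo every
prime ideal, infinitely many α ∈ 𝓞 K have α + h₁ and α + h₂ both prime elements for two distinct h₁,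
h₂ ∈ H. This is CastilloEtAl2015 Thm 1.1 (m = 2) with k₀(2, K) = 105 for totally real K, as
assembled in their §3.1 from Cor 2.6 (r_k = ⌈θ M_k/2⌉ primes at level θ), Thm 2.7 (Hinz1988: any θ <
1/2 for r₂ = 0) and Maynard's M_105 > 4; 'prime' = generates a principal prime ideal (p. 3), boxes
A(N) = totally positive elements, so the conclusion is purely ideal-theoretic. To be vendored as a
cite-tagged Literature def and used as hypothesis. [difficulty: XL] -/
@[route_item "route-Parity-UnitCliqueSymmetry"]
def MaynardTaoTotallyReal : Prop :=
  ∀ (K : Type) [Field K] [NumberField K] [NumberField.IsTotallyReal K] (H : Finset (NumberField.RingOfIntegers K)), 105 ≤ H.card → (∀ P : Ideal (NumberField.RingOfIntegers K), P.IsPrime → ∃ a : NumberField.RingOfIntegers K, ∀ h ∈ H, a - h ∉ P) → {α : NumberField.RingOfIntegers K | ∃ h₁ ∈ H, ∃ h₂ ∈ H, h₁ ≠ h₂ ∧ Prime (α + h₁) ∧ Prime (α + h₂)}.Infinite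

/-- item stmt-Parity-8863 · crux · rank 3 · closed · moot by None · by planner
why it might fail: Elementary but unwritten beyond the card's PARI check (p ≤ 23): rests on c_i − c_j = ξ_(i+j)ξ_(i−j) and the census N𝔭 ∈ {p} ∪ {ℓ^f ≡ ±1 mod p} for primes of K⁺; a slip at 𝔭 | 2 for Fermat-type p (N𝔭 = p − 1) or in modelling c_j inside Mathlib's 𝓞(maximalRealSubfield) would sink the instance.
sources: Washington1997, Lenstra1976, LeutbecherNiklasch1989, CastilloEtAl2015
[crux] (card P2, the clique — the novel, load-bearing ingredient; elementary but unwritten, hence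
ranked) for every prime p ≥ 5 and every nonzero d ∈ O⁺ = 𝓞(ℚ(ζ_p)⁺) there is H ⊂ O⁺ with |H| =
(p+1)/2, pairwise differences in O⁺ˣ·d, missing a residue class modulo every prime ideal. Witness H
= d·{c_j : 0 ≤ j ≤ (p−1)/2}, c_j = (2 − ζ^j − ζ^-j)/(2 − ζ − ζ⁻¹) = ξ_j² with ξ_a = ζ^((1−a)/2)(1 −
ζ^a)/(1 − ζ) the real cyclotomic units (Washington1997 Lemma 8.1; c_j ∈ ℤ[ζ + ζ⁻¹] ⊆ 𝓞(K⁺), Prop.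
2.16); c_i − c_j = ξ_(i+j) ξ_(i−j) ∈ O⁺ˣ for i ≠ j; admissibility: at the prime 𝔮 over p (residue
field 𝔽_p) c_j ≡ j², so d·H meets ≤ (p+1)/2 < p classes; every other prime of K⁺ has norm ℓ^f ≡ ±1
(mod p) (Washington1997 Thm 2.13 restricted to K⁺), hence ≥ p − 1 > (p+1)/2 = |d·H mod 𝔭| when d ∉ 𝔭
(differences are units), and d·H ≡ {0} when d ∈ 𝔭. Checked symbolically for p = 5,…,23 by the card's
PARI job j000139. [difficulty: L] -/
@[route_item "route-Parity-UnitCliqueSymmetry"]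
def RealCyclotomicClique : Prop :=
  ∀ p : ℕ, p.Prime → 5 ≤ p → ∀ d : NumberField.RingOfIntegers (NumberField.maximalRealSubfield (CyclotomicField p ℚ)), d ≠ 0 → ∃ H : Finset (NumberField.RingOfIntegers (NumberField.maximalRealSubfield (CyclotomicField p ℚ))), H.card = (p + 1) / 2 ∧ (∀ h₁ ∈ H, ∀ h₂ ∈ H, h₁ ≠ h₂ → ∃ u : (NumberField.RingOfIntegers (NumberField.maximalRealSubfield (CyclotomicField p ℚ)))ˣ, h₁ - h₂ = ↑u * d) ∧ ∀ P : Ideal (NumberField.RingOfIntegers (NumberField.maximalRealSubfield (CyclotomicField p ℚ))), P.IsPrime → ∃ a, ∀ h ∈ H, a - h ∉ P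

/-- item stmt-Parity-8864 · crux · rank 4 · closed · moot by None · by planner
why it might fail: Unprinted: the degree ≥ 2 generators must be negligible both in S₂ (trivial) and inside the level-of-distribution sum, O(N^(nθ+n/2+ε)) against N^n/log^B — fine for θ < 1/2 but the margin closes exactly at the θ → 1/2⁻ needed for M_105 > 4 (θ > 2/M_105 ≈ 0.4997).
sources: CastilloEtAl2015, Hinz1988, Mitsui1956, GrossSmith2000
[crux] (upgrade of X1, card K2-lite) the same conclusion with both α + h₁ and α + h₂ of RESIDUE
DEGREE ONE, i.e. |N_(K/ℚ)(α + hᵢ)| a rational prime. Expected by re-running CastilloEtAl2015 §2.3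
with the degree-one indicator: generators of degree ≥ 2 prime ideals in the box A(N) number
O(N^(n/2)(log N)^(n−1)), negligible against |P(N)| ~ c N^n/log N in S₂ and, summed over moduli of
norm ≤ |A(N)|^θ, against Hinz's level-θ bound for every θ < 1/2. It is what turns T into a statement
about pairs of RATIONAL primes (support RationalTwinNorms). [deps: MaynardTaoTotallyReal]
[difficulty: L] -/
@[route_item "route-Parity-UnitCliqueSymmetry"]
def MaynardTaoTotallyRealDegreeOne : Prop :=
  ∀ (K : Type) [Field K] [NumberField K] [NumberField.IsTotallyReal K] (H : Finset (NumberField.RingOfIntegers K)), 105 ≤ H.card → (∀ P : Ideal (NumberField.RingOfIntegers K), P.IsPrime → ∃ a : NumberField.RingOfIntegers K, ∀ h ∈ H, a - h ∉ P) → {α : NumberField.RingOfIntegers K | ∃ h₁ ∈ H, ∃ h₂ ∈ H, h₁ ≠ h₂ ∧ (Algebra.norm ℤ (α + h₁)).natAbs.Prime ∧ (Algebra.norm ℤ (α + h₂)).natAbs.Prime}.Infinite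

/-- item stmt-Parity-8865 · support · rank 9 · closed · moot by None · by planner
sources: CastilloEtAl2015, folder:Sketch.lean
[support] (card P1, symmetry pays the parity bit) R a commutative ring, P a predicate on R invariant
under multiplication by units, d ∈ R, H ⊂ R finite with h₁ − h₂ ∈ Rˣ·d for all h₁ ≠ h₂ in H: if
infinitely many α have P(α + h₁) ∧ P(α + h₂) for some h₁ ≠ h₂ ∈ H, then infinitely many γ have P γ ∧
P(γ + d). Proof: finitely many pairs ⇒ one pair (h₁, h₂) serves infinitely many α; h₁ − h₂ = u d; γ
:= u⁻¹(α + h₂) has γ + d = u⁻¹(α + h₁); α ↦ γ is injective. Used with P = Prime (Assembly) and P =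
'norm is a rational prime' (RationalTwinNorms). [difficulty: provable-now] -/
@[route_item "route-Parity-UnitCliqueSymmetry"]
def SymmetryLemma : Prop :=
  ∀ (R : Type) [CommRing R] (P : R → Prop), (∀ (u : Rˣ) (x : R), P x → P (↑u * x)) → ∀ (d : R) (H : Finset R), (∀ h₁ ∈ H, ∀ h₂ ∈ H, h₁ ≠ h₂ → ∃ u : Rˣ, h₁ - h₂ = ↑u * d) → {α : R | ∃ h₁ ∈ H, ∃ h₂ ∈ H, h₁ ≠ h₂ ∧ P (α + h₁) ∧ P (α + h₂)}.Infinite → {γ : R | P γ ∧ P (γ + d)}.Infinite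

/-- item stmt-Parity-8866 · support · rank 9 · closed · moot by None · by planner
sources: GrossSmith2000, CastilloEtAl2015, folder:Sketch.lean
[support] (glue; the rational shadow of T) MaynardTaoTotallyRealDegreeOne → RealCyclotomicClique →
SymmetryLemma → for every prime p ≥ 211 and every nonzero rational integer d, infinitely many γ ∈
𝓞(ℚ(ζ_p)⁺) have |N γ| and |N(γ + d)| both RATIONAL PRIMES — pairs of primes (ℓ, ℓ′) of the shape
(N(x), N(x + d)) for the degree-(p−1)/2 norm form of ℤ[ζ_p + ζ_p⁻¹] ≅ ℤ^((p−1)/2). Pure glue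
(sorry-free in folder Sketch.lean: the norm-prime predicate is unit-invariant since N(u) = ±1).
[difficulty: provable-now] -/
@[route_item "route-Parity-UnitCliqueSymmetry"]
def RationalTwinNorms : Prop :=
  MaynardTaoTotallyRealDegreeOne → RealCyclotomicClique → SymmetryLemma → ∀ p : ℕ, p.Prime → 211 ≤ p → ∀ d : ℤ, d ≠ 0 → {γ : NumberField.RingOfIntegers (NumberField.maximalRealSubfield (CyclotomicField p ℚ)) | (Algebra.norm ℤ γ).natAbs.Prime ∧ (Algebra.norm ℤ (γ + d)).natAbs.Prime}.Infinite

/-- item stmt-Parity-8867 · support · rank 9 · closed · moot by None · by planner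
sources: Polymath8b2014, arXiv:1407.4897, Literature.Barriers.Parity.PrimePairParity, arXiv:1910.13450
[support] (ℤ-side scope lemma, the card's 'ω(ℤ) = 2' made precise in the tree's barrier model) for
every k, every h : Fin k → ℤ and every d ≠ 0 there is a sign-pattern weight P ≥ 0 of positive mass
with BALANCED one-variable marginals vanishing on every pattern in which some pair (i, j) with h j =
h i + d is (true, true): the difference-d graph on Fin k is 2-colourable by ⌊h i/d⌋ mod 2, and P =
1[ε = σ] + 1[ε = ¬σ] for that colouring σ. With TargetGraphParity's GhostSchema (stmt-Parity-4346)
this gives ¬IsSieveTheoreticDeduction for every prescribed-difference pair target over ℤ in the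
Polymath §8 model (Literature.Barriers.Parity.PrimePairParity), for every tuple and every k —
whereas the unit-clique target in O⁺ is the complete graph K_k, ghost-free for k ≥ 3 by
BipartiteCriterion (stmt-Parity-4345). [difficulty: provable-now] -/
@[route_item "route-Parity-UnitCliqueSymmetry"]
def PrescribedDifferenceGhost : Prop :=
  ∀ (k : ℕ) (h : Fin k → ℤ) (d : ℤ), d ≠ 0 → ∃ P : (Fin k → Bool) → ℝ, (∀ ε, 0 ≤ P ε) ∧ 0 < ∑ ε, P ε ∧ (∀ ε, (∃ i j, h j = h i + d ∧ ε i = true ∧ ε j = true) → P ε = 0) ∧ ∀ i, ∑ ε, (if ε i then P ε else 0) = ∑ ε, (if ε i then 0 else P ε)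

/-- item stmt-Parity-8868 · assembly · rank 1 · closed · moot by None · by planner
sources: CastilloEtAl2015, folder:Sketch.lean
[assembly] MaynardTaoTotallyReal → RealCyclotomicClique → SymmetryLemma → RealCyclotomicPrimePairs
(bookkeeping; conclusion = the declared next-door Target). -/
@[route_item "route-Parity-UnitCliqueSymmetry"]
def Assembly : Prop :=
  MaynardTaoTotallyReal → RealCyclotomicClique → SymmetryLemma → RealCyclotomicPrimePairs

end Summit.Parity.GeneralizedHardyLittlewood.Theses.UnitCliqueSymmetry
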